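import Literature.MathematicalPhysics.QuantumFieldTheory.Balaban1983to89.T4MatchingClosureSocket
import Literature.MathematicalPhysics.QuantumFieldTheory.Balaban1983to89.T4ShellMeasure

/-!
# T4ShellMeasureSocket — node U5b/U5.E, cell input NE7c: the LIVE-FACTOR producer (design row T4-U5b.E2, shell-measure
route, member (δ-1)) PLUGGED INTO the seam-(ζ′) socket of the closure chain

HONEST FRAMING.  Rung (B)+1 scoping of the T⁴-continuum cell (existence and uniqueness of the `ε → 0` limit of
unit-scale averaged expectations on a FIXED finite torus): NOT infinite volume, NOT a mass gap, NOT Clay, and NOT a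
proof of NE7c.  KERNEL BOOKKEEPING ONLY (0 estimates): every analytic input is a BINDER.  Nothing of the run-A/run-B
comparison is printed in [Balaban 1983–89] (the manuscripts construct ONE run); nothing printed is asserted here and no
constant of Bałaban's is chosen.  Every conditional of the cell (BetaPertH, (B), (B^μ)) stays where it is — upstream of
the term families, untouched.

WHY THIS LEAF.  `T4ShellMeasure.shellWeightBound_of_liveFactor` (§8e of that module) produces the NE7c socket datum
`T4IndicatorShell.ShellWeightBound l₀ T (A ∘ i⋆) (B ∘ i⋆) (shA ∘ i⋆) (shB ∘ i⋆) Wsh` for the two runs' term families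
WRITTEN WITH ONE CHOSEN THRESHOLD CONVENTION `i⋆ K < n K` PER COMPARISON `K` (the live common factor
`λ_{i⋆ K} = (1 − ρ⋆_K)^{i⋆ K}` on the booked tests of both runs), the choice being made by a pigeonhole over the `n K`
candidates.  `T4MatchingClosureSocket.hybridNE7_closure'_tail` (seam (ζ′)) consumes ANY such datum together with the
NE7b half `RelWeightBound`, the good-class budget `ReindexedBudget` on the hybrid cores and four summable rates.  Since
the convention `i⋆` is not known before the pigeonhole, the OTHER producers must deliver their structures for the
`c`-DIAGONAL families `K ↦ A K (c K)` of EVERY choice function `c` — this is the precise kernel sense of the located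
(not printed) robustness input (L1-step) of record t4/T4-EST-NE7c-P1.md §3 — and the E1/E2 dictionary must identify the
string's dressed partition functions with the term sums of EVERY candidate expansion — the located input (L2b): «the
integrals are threshold-free» (B15 p.193: the threshold-introducing operations are equivalences of densities, equal
integrals).  This leaf TYPES both as binders and composes the two landed theorems; it keeps `T4ShellMeasure`'s import
cone minimal (that module imports `T4IndicatorShell` only) instead of bumping it.

WHAT THIS LEAF DOES.
* §1 K-LOCALITY (`relWeightBound_diagonal`, `reindexedBudget_diagonal`): both consumer structures have per-`K` fields
  only (the global fields of `RelWeightBound` concern `W` alone), so the structure for every CONSTANT convention `i`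
  gives it for every choice function `c` — the shape in which (L1-step) is asked of the NE7b / budget producers.
* §2 `hybridNE7_tail_of_liveFactor` = `T4ShellMeasure.shellWeightBound_of_liveFactor` ∘
  `T4MatchingClosureSocket.hybridNE7_closure'_tail`: the (δ-1) data (slot ledgers for every choice function, cascade
  totals `≤ V·Z` [(R) decision-tree reading + (W1) bounded live window], candidate-count rate `2/n K ≤ M·ϑ^K`
  [(F∞)-rate]) + the NE7b half and the cores' budget for every choice function [(L1-step)] + four summable rates ⇒
  `∃ i⋆ (i⋆ K < n K) ∃ K₀`, a `HybridNE7` datum for the `i⋆`-DIAGONAL, `K₀`-SHIFTED families, with the explicit shell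
  weight `Wsh = ω^A + ω^B` of the two chosen ledgers.
* §3 `stringHybridNE7_of_liveFactor`: per string of a torus scheme, with the E1/E2 dictionary holding for EVERY
  candidate [(L2b)] and the scheme's regularity (`0 ≤ β_K`, measurable observables bounded by `1`, `0 ≤ l₀`)
  discharging the positivity / partition-of-unity inputs `hZA0 hZB0 hZAle hZBle` of the pigeonhole
  (`T4GenFunBounds.dressedZ_pos`), the conclusion `∃ K₁, StringHybridNE7 S os l₀ vol (K₀ + K₁)` is CONVENTION-FREE —
  literally the per-string hypothesis of `T4MatchingClosureHosts.hasContinuumLimit_of_stringClosures` /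
  `T4MatchingAssembly.genFunCauchy_of_hybridNE7`.
* §4 `liveFactor_margin` (census item C1 of the record, TYPED): the one LOSS item of (L1-step) — a failed live test's
  small factor carries the exponent `× λ²`, `λ ≥ λ₀ = 1 − β′ > 0` — is absorbed by ANY strict power margin `p < q` of
  the logarithm beyond the explicit infrared threshold `log g⁻² ≥ max 1 (A₁/(λ₀²A₂))`:
  `p0Profile A₁ p g ≤ λ²·p0Profile A₂ q g`, hence `exp(−λ²·p0Profile A₂ q g) ≤ exp(−p0Profile A₁ p g)` (the printed
  sentence B16 p.383 «We assume that 2p₁ − (d + 5)r₀ > p₀, and we estimate the factors by exp(−p₀(g_j))» read with the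
  live factor; kernel by `T4PersistentHistoryCount.gammaClause_of_large`).  Pure real arithmetic; it does NOT verify
  that C1 is the only loss item (the completeness of the census over B14–B16 is NOT PRINTED, GAPS G-ne7cp1-2).
* §5 sanity: non-vacuity of §2's binder list on the trivial datum (kernel-checked), honest scope.

LOCATED, NOT PRINTED, NOT DISCHARGED HERE (they are the binder blocks of §2/§3): (R) the decision-tree reading of the
expansion (2.18) and (W1) the bounded live window — inside `htotA`/`htotB` (cascade count `V`); the (F∞)-rate
`ρ⋆_K ≤ 2c₁ϑ^{K − N₁}` — inside `hrate`; (L1-step) — the `∀ c` binders `hA hB hW hTB`; (L2b) — the `∀ i` dictionary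
`hZA hZB` of §3.  GAPS rows G-ne7cp1-2, G-ne7cp1-3, G-ne7cp1-4.

ABSOLUTE RULE.  No internally-minted statement is a cited fact; every hypothesis is a binder; nothing of
[Balaban 1983–89] is instantiated or quoted as authority for a disputed step; all docstrings [folklore]; 0 sorry.
-/

open Finset

namespace Literature.MathematicalPhysics.QuantumFieldTheory.Balaban1983to89.T4ShellMeasureSocket

open Literature.MathematicalPhysics.QuantumFieldTheory.Balaban1983to89
open T4WeightBudget T4IndicatorShell T4MatchingAssembly T4MatchingClosure T4MatchingClosureSocket T4ShellMeasure
  T4PersistentHistoryCount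

/-! ## §1 K-locality: the consumer structures for every constant convention give them for every choice function -/

section Diagonal

variable {ι : Type*} {l₀ vol : ℝ} {T : ℕ → Finset ι} {A B : ℕ → ℕ → ℝ → ι → ℝ} {Bad : ℕ → ℕ → ℝ → Finset ι}
  {Cc Rr CcRec RrRec : ℕ → ℕ → ℝ → ι → ℝ} {ν c₀ : ℕ → ℕ → ℝ} {u s₂ r s W : ℕ → ℝ}

/-- **K-LOCALITY OF THE NE7b HALF.**  Candidate-indexed term families `A K i`, `B K i`, bad classes `Bad K i`
(`i` = the threshold convention of comparison `K`): if for every CONSTANT convention `i` the families `K ↦ A K i`, …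
carry `RelWeightBound … W`, then so do the DIAGONAL families `K ↦ A K (c K)` of every choice function `c` (every field
is per `K` except those on `W`).  The shape in which (L1-step) is asked of the NE7b producer. [folklore] -/
theorem relWeightBound_diagonal
    (h : ∀ i, RelWeightBound l₀ T (fun K => A K i) (fun K => B K i) (fun K => Bad K i) W) (c : ℕ → ℕ) :
    RelWeightBound l₀ T (fun K => A K (c K)) (fun K => B K (c K)) (fun K => Bad K (c K)) W where
  bad_subset K := (h (c K)).bad_subset K
  nonneg := (h 0).nonneg
  lt_one := (h 0).lt_one
  summable := (h 0).summable
  bad_left K := (h (c K)).bad_left K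
  bad_right K := (h (c K)).bad_right K

/-- **K-LOCALITY OF THE GOOD-CLASS BUDGET.**  Same for `T4MatchingClosure.ReindexedBudget` (all seven fields are per
`K`; the per-term data `Cc Rr CcRec RrRec` and the constants `ν`, `c₀` may depend on the convention, the four rates
`u s₂ r s` not).  For the hybrid cores instantiate `A := fun K i t τ => A K i t τ - shA K i t τ` etc.: the conclusion
is then the binder `hTB c` of `hybridNE7_tail_of_liveFactor` (§2) by `rfl`. [folklore] -/
theorem reindexedBudget_diagonal [DecidableEq ι]
    (h : ∀ i, ReindexedBudget l₀ vol T (fun K => A K i) (fun K => B K i) (fun K => Bad K i) (fun K => Cc K i)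
      (fun K => Rr K i) (fun K => CcRec K i) (fun K => RrRec K i) (fun K => ν K i) u s₂ (fun K => c₀ K i) r s)
    (c : ℕ → ℕ) :
    ReindexedBudget l₀ vol T (fun K => A K (c K)) (fun K => B K (c K)) (fun K => Bad K (c K)) (fun K => Cc K (c K))
      (fun K => Rr K (c K)) (fun K => CcRec K (c K)) (fun K => RrRec K (c K)) (fun K => ν K (c K)) u s₂
      (fun K => c₀ K (c K)) r s where
  nonneg K := (h (c K)).nonneg K
  lower K := (h (c K)).lower K
  upper K := (h (c K)).upper K
  uv_const K := (h (c K)).uv_const K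
  uv_radius K := (h (c K)).uv_radius K
  recent_remainder K := (h (c K)).recent_remainder K
  recent_deviation K := (h (c K)).recent_deviation K

end Diagonal

/-! ## §2 The live-factor producer through the socket: a `HybridNE7` datum for the diagonal, shifted families -/

section Tail

variable {ι σ σ' : Type*} [DecidableEq ι] {l₀ a ϑ V M vol : ℝ} {T : ℕ → Finset ι}

/-- **NE7c BY THE LIVE COMMON FACTOR, THROUGH THE SEAM-(ζ′) SOCKET.**  Hypotheses: verbatim those of
`T4ShellMeasure.shellWeightBound_of_liveFactor` — per `K`, `n K ≥ 1` candidate conventions; both runs' expansions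
written with the candidate factor form slot ledgers FOR EVERY CHOICE FUNCTION [(L1-step), shell side]; candidate-summed
shell totals under the cascade bound `≤ V·Z` [(R) + (W1)] with `0 < Z ≤` every candidate's total weight at `t = 0`;
the candidate-count rate `2/n K ≤ M·ϑ^K`, `0 ≤ ϑ < 1` [(F∞)-rate] — PLUS, for every choice function `c`, the NE7b half
`RelWeightBound` of the `c`-diagonal families and the good-class `ReindexedBudget` on their hybrid cores [(L1-step),
weight and budget sides; K-local data enter through §1] with convention-free rates `u s₂ r s`, summable.  Conclusion:
ONE convention `i⋆ K < n K` per `K` and an origin `K₀` such that the `i⋆`-DIAGONAL families, shifted to `K₀ + K`, carry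
`T4MatchingAssembly.HybridNE7` with shell weight `ω^A + ω^B` of the two chosen ledgers and remainder rate
`(r + u) + (s + s₂)`.  (= `shellWeightBound_of_liveFactor`, then `hybridNE7_closure'_tail`; the weight condition
`W + Wsh < 1` on the tail is free from the two structures' `summable` fields.)  CONDITIONAL on its binders; nothing
PRINTED is asserted. [folklore] -/
theorem hybridNE7_tail_of_liveFactor (n : ℕ → ℕ) (hn : ∀ K, 0 < n K)
    {A B shA shB : ℕ → ℕ → ℝ → ι → ℝ} {SA : ℕ → Finset σ} {SB : ℕ → Finset σ'}
    {pieceA : ℕ → ℕ → ℝ → σ → ι → ℝ} {pieceB : ℕ → ℕ → ℝ → σ' → ι → ℝ}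
    (hA : ∀ c : ℕ → ℕ, SlotLedger l₀ T (fun K => A K (c K)) (fun K => shA K (c K)) SA (fun K => pieceA K (c K))
      (fun K s => Real.exp (2 * a) * ((∑ τ ∈ T K, pieceA K (c K) 0 s τ) / ∑ τ ∈ T K, A K (c K) 0 τ)))
    (hB : ∀ c : ℕ → ℕ, SlotLedger l₀ T (fun K => B K (c K)) (fun K => shB K (c K)) SB (fun K => pieceB K (c K))
      (fun K s => Real.exp (2 * a) * ((∑ τ ∈ T K, pieceB K (c K) 0 s τ) / ∑ τ ∈ T K, B K (c K) 0 τ)))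
    (hpA0 : ∀ K i, 0 ≤ ∑ s ∈ SA K, ∑ τ ∈ T K, pieceA K i 0 s τ)
    (hpB0 : ∀ K i, 0 ≤ ∑ s ∈ SB K, ∑ τ ∈ T K, pieceB K i 0 s τ)
    {ZA ZB : ℕ → ℝ} (hZA0 : ∀ K, 0 < ZA K) (hZB0 : ∀ K, 0 < ZB K)
    (hZAle : ∀ K i, ZA K ≤ ∑ τ ∈ T K, A K i 0 τ) (hZBle : ∀ K i, ZB K ≤ ∑ τ ∈ T K, B K i 0 τ)
    (hV : 0 ≤ V)
    (htotA : ∀ K, ∑ i ∈ range (n K), ∑ s ∈ SA K, ∑ τ ∈ T K, pieceA K i 0 s τ ≤ V * ZA K)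
    (htotB : ∀ K, ∑ i ∈ range (n K), ∑ s ∈ SB K, ∑ τ ∈ T K, pieceB K i 0 s τ ≤ V * ZB K)
    (hrate : ∀ K, (2 : ℝ) / n K ≤ M * ϑ ^ K) (hϑ0 : 0 ≤ ϑ) (hϑ1 : ϑ < 1)
    {Bad : (ℕ → ℕ) → ℕ → ℝ → Finset ι} {W : (ℕ → ℕ) → ℕ → ℝ}
    (hW : ∀ c : ℕ → ℕ, RelWeightBound l₀ T (fun K => A K (c K)) (fun K => B K (c K)) (Bad c) (W c))
    {Cc Rr CcRec RrRec : (ℕ → ℕ) → ℕ → ℝ → ι → ℝ} {ν c₀ : (ℕ → ℕ) → ℕ → ℝ} {u s₂ r s : ℕ → ℝ}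
    (hTB : ∀ c : ℕ → ℕ, ReindexedBudget l₀ vol T (fun K t τ => A K (c K) t τ - shA K (c K) t τ)
      (fun K t τ => B K (c K) t τ - shB K (c K) t τ) (Bad c) (Cc c) (Rr c) (CcRec c) (RrRec c) (ν c) u s₂ (c₀ c) r s)
    (hr : Summable r) (hu : Summable u) (hs : Summable s) (hs₂ : Summable s₂) :
    ∃ istar : ℕ → ℕ, (∀ K, istar K < n K) ∧ ∃ K₀ : ℕ,
      HybridNE7 l₀ vol (fun K => T (K₀ + K)) (fun K => A (K₀ + K) (istar (K₀ + K)))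
        (fun K => B (K₀ + K) (istar (K₀ + K))) (fun K => Bad istar (K₀ + K)) (fun K => W istar (K₀ + K))
        (fun K => shA (K₀ + K) (istar (K₀ + K))) (fun K => shB (K₀ + K) (istar (K₀ + K)))
        (fun K => (hA istar).omega (K₀ + K) + (hB istar).omega (K₀ + K))
        (fun K => (r (K₀ + K) + u (K₀ + K)) + (s (K₀ + K) + s₂ (K₀ + K))) := by
  obtain ⟨istar, hlt, hSh⟩ := shellWeightBound_of_liveFactor n hn hA hB hpA0 hpB0 hZA0 hZB0 hZAle hZBle hV htotA
    htotB hrate hϑ0 hϑ1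
  obtain ⟨K₀, h⟩ := hybridNE7_closure'_tail (hW istar) hSh (hTB istar) hr hu hs hs₂
  exact ⟨istar, hlt, K₀, h⟩

end Tail

/-! ## §3 Per string: the convention-free conclusion `∃ K₁, StringHybridNE7 S os l₀ vol (K₀ + K₁)` -/

section SchemeTail

open Missing T4Continuum T4Assembly

variable {G : Type*} [GaugeGroup G] [MeasurableSpace G] [RegularGaugeGroup G] [HaarData G] {O : Type*}

/-- **PER STRING, NE7c BY THE LIVE COMMON FACTOR, END TO END.**  For one string `os` of a torus scheme `S` with
`0 ≤ β_K`, measurable observables bounded by `1` and `0 ≤ l₀`: the (δ-1) data of `hybridNE7_tail_of_liveFactor` for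
the two runs after `K₀ + K` resp. `K₀ + K + 1` steps, the cascade totals now measured against the string's OWN dressed
partition functions at `t = 0`, the `∀ c` NE7b / budget binders [(L1-step)], four summable rates, and the E1/E2
dictionary FOR EVERY CANDIDATE CONVENTION `i` [(L2b): `schemeZ S os (K₀ + K) t = Σ_τ A K i t τ`,
`schemeZ S os (K₀ + K + 1) t = Σ_τ B K i t τ` on `|t| ≤ l₀` — the integrals are threshold-free] give
`∃ K₁, StringHybridNE7 S os l₀ vol (K₀ + K₁)`: NO convention, NO candidate index, NO shell weight is visible in the
conclusion.  Positivity of the totals and the inputs `hZA0 hZB0 hZAle hZBle` of the pigeonhole are DISCHARGED by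
`T4GenFunBounds.dressedZ_pos` and the dictionary at `t = 0`; the packaging is `T4MatchingClosure.stringHybridNE7_of_shift`.
CONDITIONAL on its binders; nothing PRINTED is asserted. [folklore] -/
theorem stringHybridNE7_of_liveFactor (S : TorusScheme G O) (os : List O) (K₀ : ℕ) {ι : Type} [DecidableEq ι]
    {σ σ' : Type*} {l₀ a ϑ V M vol : ℝ} {T : ℕ → Finset ι} (n : ℕ → ℕ) (hn : ∀ K, 0 < n K)
    {A B shA shB : ℕ → ℕ → ℝ → ι → ℝ} {SA : ℕ → Finset σ} {SB : ℕ → Finset σ'}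
    {pieceA : ℕ → ℕ → ℝ → σ → ι → ℝ} {pieceB : ℕ → ℕ → ℝ → σ' → ι → ℝ}
    (hA : ∀ c : ℕ → ℕ, SlotLedger l₀ T (fun K => A K (c K)) (fun K => shA K (c K)) SA (fun K => pieceA K (c K))
      (fun K s => Real.exp (2 * a) * ((∑ τ ∈ T K, pieceA K (c K) 0 s τ) / ∑ τ ∈ T K, A K (c K) 0 τ)))
    (hB : ∀ c : ℕ → ℕ, SlotLedger l₀ T (fun K => B K (c K)) (fun K => shB K (c K)) SB (fun K => pieceB K (c K))
      (fun K s => Real.exp (2 * a) * ((∑ τ ∈ T K, pieceB K (c K) 0 s τ) / ∑ τ ∈ T K, B K (c K) 0 τ)))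
    (hpA0 : ∀ K i, 0 ≤ ∑ s ∈ SA K, ∑ τ ∈ T K, pieceA K i 0 s τ)
    (hpB0 : ∀ K i, 0 ≤ ∑ s ∈ SB K, ∑ τ ∈ T K, pieceB K i 0 s τ)
    (hV : 0 ≤ V)
    (htotA : ∀ K, ∑ i ∈ range (n K), ∑ s ∈ SA K, ∑ τ ∈ T K, pieceA K i 0 s τ ≤
      V * T4GenFunBounds.schemeZ S os (K₀ + K) 0)
    (htotB : ∀ K, ∑ i ∈ range (n K), ∑ s ∈ SB K, ∑ τ ∈ T K, pieceB K i 0 s τ ≤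
      V * T4GenFunBounds.schemeZ S os (K₀ + K + 1) 0)
    (hrate : ∀ K, (2 : ℝ) / n K ≤ M * ϑ ^ K) (hϑ0 : 0 ≤ ϑ) (hϑ1 : ϑ < 1)
    {Bad : (ℕ → ℕ) → ℕ → ℝ → Finset ι} {W : (ℕ → ℕ) → ℕ → ℝ}
    (hW : ∀ c : ℕ → ℕ, RelWeightBound l₀ T (fun K => A K (c K)) (fun K => B K (c K)) (Bad c) (W c))
    {Cc Rr CcRec RrRec : (ℕ → ℕ) → ℕ → ℝ → ι → ℝ} {ν c₀ : (ℕ → ℕ) → ℕ → ℝ} {u s₂ r s : ℕ → ℝ}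
    (hTB : ∀ c : ℕ → ℕ, ReindexedBudget l₀ vol T (fun K t τ => A K (c K) t τ - shA K (c K) t τ)
      (fun K t τ => B K (c K) t τ - shB K (c K) t τ) (Bad c) (Cc c) (Rr c) (CcRec c) (RrRec c) (ν c) u s₂ (c₀ c) r s)
    (hr : Summable r) (hu : Summable u) (hs : Summable s) (hs₂ : Summable s₂)
    (hβ : ∀ K, 0 ≤ S.β K) (hm : ∀ K o, Measurable (S.obs K o)) (h1 : ∀ K o U, |S.obs K o U| ≤ 1) (hl₀ : 0 ≤ l₀)
    (hZA : ∀ K i t, |t| ≤ l₀ → T4GenFunBounds.schemeZ S os (K₀ + K) t = ∑ τ ∈ T K, A K i t τ)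
    (hZB : ∀ K i t, |t| ≤ l₀ → T4GenFunBounds.schemeZ S os (K₀ + K + 1) t = ∑ τ ∈ T K, B K i t τ) :
    ∃ K₁, StringHybridNE7 S os l₀ vol (K₀ + K₁) := by
  have hpos : ∀ K', 0 < T4GenFunBounds.schemeZ S os K' 0 := fun K' => by
    unfold T4GenFunBounds.schemeZ
    exact T4GenFunBounds.dressedZ_pos (S.P K') (hβ K') (T4GenFunBounds.measurable_prodObs S hm K' os)
      (T4GenFunBounds.abs_prodObs_le_one S h1 K' os) 0
  have ht0 : |(0 : ℝ)| ≤ l₀ := by rwa [abs_zero]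
  obtain ⟨istar, -, K₁, h⟩ := hybridNE7_tail_of_liveFactor (vol := vol) n hn hA hB hpA0 hpB0
    (fun K => hpos (K₀ + K)) (fun K => hpos (K₀ + K + 1)) (fun K i => (hZA K i 0 ht0).le)
    (fun K i => (hZB K i 0 ht0).le) hV htotA htotB hrate hϑ0 hϑ1 hW hTB hr hu hs hs₂
  exact ⟨K₁, stringHybridNE7_of_shift (A := fun K => A K (istar K)) (B := fun K => B K (istar K)) S os K₀ K₁ h
    (fun K t ht => hZA K (istar K) t ht) (fun K t ht => hZB K (istar K) t ht)⟩

end SchemeTail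

/-! ## §4 Census item C1 typed: a strict power margin absorbs the live factor beyond an explicit threshold -/

section Margin

/-- **THE LIVE FACTOR COSTS NOTHING BEYOND A THRESHOLD** (census item C1 of record t4/T4-EST-NE7c-P1.md §3, the one
loss item of (L1-step), TYPED): for amplitudes `A₂ > 0`, `A₁`, exponents `p < q`, and factors `λ ≥ λ₀ > 0`:
`A₁·y^p ≤ λ²·(A₂·y^q)` for every `y ≥ max 1 (A₁/(λ₀²A₂))`.  (`gammaClause_of_large` with `B := A₁`, `cA := λ₀²A₂`,
`n := q − p`, times `y^p`.) [folklore] -/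
theorem liveFactor_margin {A₁ A₂ lam₀ lam y : ℝ} {p q : ℕ} (hA₂ : 0 < A₂) (h0 : 0 < lam₀) (hle : lam₀ ≤ lam)
    (hpq : p < q) (hy : max 1 (A₁ / (lam₀ ^ 2 * A₂)) ≤ y) : A₁ * y ^ p ≤ lam ^ 2 * (A₂ * y ^ q) := by
  have hcA : 0 < lam₀ ^ 2 * A₂ := mul_pos (pow_pos h0 2) hA₂
  have hy0 : 0 ≤ y := zero_le_one.trans (le_trans (le_max_left _ _) hy)
  have h1 : A₁ ≤ (lam₀ ^ 2 * A₂) * y ^ (q - p) := gammaClause_of_large hcA (by omega) hy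
  have hlam : lam₀ ^ 2 ≤ lam ^ 2 := pow_le_pow_left₀ h0.le hle 2
  have hyq : y ^ (q - p) * y ^ p = y ^ q := by rw [← pow_add, Nat.sub_add_cancel hpq.le]
  calc A₁ * y ^ p ≤ ((lam₀ ^ 2 * A₂) * y ^ (q - p)) * y ^ p := mul_le_mul_of_nonneg_right h1 (pow_nonneg hy0 p)
    _ = lam₀ ^ 2 * (A₂ * (y ^ (q - p) * y ^ p)) := by ring
    _ = lam₀ ^ 2 * (A₂ * y ^ q) := by rw [hyq]
    _ ≤ lam ^ 2 * (A₂ * y ^ q) := mul_le_mul_of_nonneg_right hlam (mul_nonneg hA₂.le (pow_nonneg hy0 q))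

/-- … in the currency of the small-field profiles `p0Profile A p g = A·(log g⁻²)^p` of [B14] (1.1): beyond the infrared
threshold `log g⁻² ≥ max 1 (A₁/(λ₀²A₂))` («`g_j` sufficiently small», depending on the slack `λ₀ = 1 − β′` only),
`p0Profile A₁ p g ≤ λ²·p0Profile A₂ q g` for every `λ ≥ λ₀` and `p < q`. [folklore] -/
theorem liveFactor_margin_p0Profile {A₁ A₂ lam₀ lam g : ℝ} {p q : ℕ} (hA₂ : 0 < A₂) (h0 : 0 < lam₀)
    (hle : lam₀ ≤ lam) (hpq : p < q) (hg : max 1 (A₁ / (lam₀ ^ 2 * A₂)) ≤ Real.log (g ^ 2)⁻¹) :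
    p0Profile A₁ p g ≤ lam ^ 2 * p0Profile A₂ q g := by
  unfold p0Profile
  exact liveFactor_margin hA₂ h0 hle hpq hg

/-- … hence the failed LIVE test's small factor, whose exponent carries `λ²` (threshold `λ·ε_j` instead of `ε_j`), is
still estimated by the strictly lower power: `exp(−λ²·p0Profile A₂ q g) ≤ exp(−p0Profile A₁ p g)` — the printed
sentence [B16] p.383 «We assume that 2p₁ − (d + 5)r₀ > p₀, and we estimate the factors by exp(−p₀(g_j))» read with the
live factor (print's `p₀²(g_j)` is the exponent-`2p₀` profile, `T4PersistentHistoryCount.p0Profile_sq`).  This types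
the ABSORPTION of census item C1; it does not verify that C1 is the census's only loss item (NOT PRINTED). [folklore] -/
theorem exp_liveFactor_le_exp {A₁ A₂ lam₀ lam g : ℝ} {p q : ℕ} (hA₂ : 0 < A₂) (h0 : 0 < lam₀) (hle : lam₀ ≤ lam)
    (hpq : p < q) (hg : max 1 (A₁ / (lam₀ ^ 2 * A₂)) ≤ Real.log (g ^ 2)⁻¹) :
    Real.exp (-(lam ^ 2 * p0Profile A₂ q g)) ≤ Real.exp (-(p0Profile A₁ p g)) :=
  Real.exp_le_exp.mpr (neg_le_neg (liveFactor_margin_p0Profile hA₂ h0 hle hpq hg))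

end Margin

/-! ## §5 Sanity: non-vacuity of §2's binder list (honest scope) -/

section Sanity

/-- SANITY: a run with NO slots and ZERO shell parts is a slot ledger of any nonnegative term family, for any
per-slot constants. [folklore] -/
theorem slotLedger_noSlots {ι σ : Type*} (l₀ : ℝ) (T : ℕ → Finset ι) (A : ℕ → ℝ → ι → ℝ)
    (hA : ∀ K t, |t| ≤ l₀ → ∀ τ ∈ T K, 0 ≤ A K t τ) (piece : ℕ → ℝ → σ → ι → ℝ) (c : ℕ → σ → ℝ) :
    SlotLedger l₀ T A (fun _ _ _ => 0) (fun _ => (∅ : Finset σ)) piece c where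
  sh_nonneg _ _ _ _ _ := le_rfl
  sh_le := hA
  cover _ _ _ _ _ := by simp
  slot _ _ _ s hs := by simp at hs
  c_nonneg _ s hs := by simp at hs

-- SANITY (non-vacuity of `hybridNE7_tail_of_liveFactor`'s binder list, honest scope): one term of weight `1` per `K`
-- in both runs, no slots, zero shell parts and pieces, `n K = 2^K` candidate conventions (rate `2/2^K = 2·(1/2)^K`),
-- cascade constant `V = 0`, the trivial NE7b half and the trivial budget on the cores `1 − 0` of
-- `T4MatchingAssembly.hybridNE7_trivial` / `T4MatchingClosureSocket.reindexedBudget_trivial_cores`, zero rates: the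
-- theorem fires (kernel-checked; all families being constant in `K`, the origin shift `K₀` is invisible in the
-- conclusion).  Shows only that the hypotheses are jointly satisfiable; the content of NE7c is in the binders.
example (l₀ a vol : ℝ) :
    ∃ istar : ℕ → ℕ, (∀ K, istar K < 2 ^ K) ∧ ∃ Wsh : ℕ → ℝ,
      HybridNE7 l₀ vol (fun _ => ({()} : Finset Unit)) (fun _ _ _ => 1) (fun _ _ _ => 1) (fun _ _ => ∅) (fun _ => 0)
        (fun _ _ _ => 0) (fun _ _ _ => 0) Wsh (fun _ => ((0 : ℝ) + 0) + (0 + 0)) := by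
  obtain ⟨istar, hlt, K₀, h⟩ := hybridNE7_tail_of_liveFactor (σ := Unit) (σ' := Unit) (l₀ := l₀) (a := a)
    (ϑ := 2⁻¹) (V := 0) (M := 2) (vol := vol) (T := fun _ => ({()} : Finset Unit)) (fun K => 2 ^ K)
    (fun K => pow_pos two_pos K)
    (A := fun _ _ _ _ => (1 : ℝ)) (B := fun _ _ _ _ => (1 : ℝ)) (shA := fun _ _ _ _ => 0) (shB := fun _ _ _ _ => 0)
    (SA := fun _ => (∅ : Finset Unit)) (SB := fun _ => (∅ : Finset Unit)) (pieceA := fun _ _ _ _ _ => 0)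
    (pieceB := fun _ _ _ _ _ => 0)
    (fun _ => slotLedger_noSlots l₀ _ _ (fun _ _ _ _ _ => zero_le_one) _ _)
    (fun _ => slotLedger_noSlots l₀ _ _ (fun _ _ _ _ _ => zero_le_one) _ _)
    (fun _ _ => by simp) (fun _ _ => by simp) (ZA := fun _ => 1) (ZB := fun _ => 1) (fun _ => one_pos)
    (fun _ => one_pos) (fun _ _ => by simp) (fun _ _ => by simp) le_rfl (fun _ => by simp) (fun _ => by simp)
    (fun K => le_of_eq (by push_cast; rw [inv_pow, div_eq_mul_inv])) (by norm_num) (by norm_num)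
    (Bad := fun _ _ _ => ∅) (W := fun _ _ => 0) (fun _ => (hybridNE7_trivial l₀ vol).weight)
    (Cc := fun _ _ _ _ => 0) (Rr := fun _ _ _ _ => 0) (CcRec := fun _ _ _ _ => 0) (RrRec := fun _ _ _ _ => 0)
    (ν := fun _ _ => 0) (c₀ := fun _ _ => 0) (u := fun _ => 0) (s₂ := fun _ => 0) (r := fun _ => 0) (s := fun _ => 0)
    (fun _ => reindexedBudget_trivial_cores l₀ vol) summable_zero summable_zero summable_zero summable_zero
  exact ⟨istar, hlt, _, h⟩

end Sanity

end Literature.MathematicalPhysics.QuantumFieldTheory.Balaban1983to89.T4ShellMeasureSocket
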